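import Summits.CriticalPhenomena.SAWScalingLimit.Theses.SAWRenewalTightness
import Summits.CriticalPhenomena.SAWScalingLimit.Theorems.SAWRenewalTightnessTightOfShellCrossing

/-!
# `EventualTight`, line `Sketch`, stub S1 `stub_confinement`: eventual confinement

Crux stmt-CriticalPhenomena-1372 (`SAWRenewalTightness.EventualTight`), line `Sketch`, stub S1
`stub_confinement`: eventual confinement of the critical SAW polylines in ONE compact disc.  For a
Dobrushin domain `D` and an endpoint approximation `(a_δ, b_δ)` there are `L` and `δ₀ > 0` such that
for every mesh `δ ∈ (0, δ₀]` every SAW polyline of `Ω_δ` from `a_δ` to `b_δ` lies in `B̄(0, L)`.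

The Disproof §2 endpoint limits are spent here (and only here on the line): every vertex of the walk
after the first lies in the discrete domain `Ω_δ ⊆ Ω ⊆ B̄(0, r)` (`D.isBounded.subset_closedBall 0`,
`mem_meshDomain_of_mem_tail_support`, `meshDomain_subset_meshVertices`), the first vertex `δ·a_δ`
lies in `B(a, 1)` for `δ < δ₂` (`IsEndpointApprox.tendsto_fst`), and discs are convex, so the
piecewise-linear polyline stays in the disc `B̄(0, L)`, `L = max r 0 + ‖a‖ + 1`
(`range_toCurve_domainSAW_subset`).  We take `δ₀ = δ₂ / 2`.
-/

noncomputable section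

open MeasureTheory Filter Topology Set Metric
open scoped ENNReal NNReal unitInterval
open Literature.Probability.RandomPlanarGeometry Literature.Probability.LatticeModels

namespace Summit.CriticalPhenomena.SAWScalingLimit.Theorems

/-- **Eventual confinement** (line `Sketch`, stub S1): for every Dobrushin domain `D` and endpoint
approximation `(a_δ, b_δ)` there are `L` and `δ₀ > 0` such that, for all meshes `δ ∈ (0, δ₀]`, the
polyline of every self-avoiding walk of `Ω_δ` from `a_δ` to `b_δ` lies in the disc `B̄(0, L)`:
the vertices after the first are mesh points of `Ω_δ ⊆ Ω`, which is bounded, the first vertex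
`δ·a_δ` tends to the marked point `a`, and discs are convex. [folklore] -/
theorem stub_confinement :
    ∀ (D : DobrushinDomain) (a b : ℝ → Site 2), SAW.IsEndpointApprox D a b →
      ∃ (L δ₀ : ℝ), 0 < δ₀ ∧ ∀ δ ∈ Set.Ioc (0 : ℝ) δ₀,
        ∀ γ : SAW.DomainSAW D.carrier δ (a δ) (b δ),
          (⟨γ.walk.toCurve (meshPoint δ)⟩ : Curve ℂ).range ⊆ Metric.closedBall (0 : ℂ) L := by
  intro D a b hab
  -- the endpoint `a_δ` is within `1` of the marked point `a` for small `δ`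
  have hnear : ∀ᶠ δ in 𝓝[>] (0 : ℝ), meshPoint δ (a δ) ∈ ball (D.pt 0) 1 :=
    hab.tendsto_fst.eventually_mem (ball_mem_nhds _ one_pos)
  obtain ⟨δ₂, hδ₂, hsub₂⟩ := mem_nhdsGT_iff_exists_Ioo_subset.1 hnear
  have hδ₂' : (0 : ℝ) < δ₂ := hδ₂
  -- a disc containing the domain and the unit disc about `a`
  obtain ⟨r, hr⟩ := D.isBounded.subset_closedBall (0 : ℂ)
  set rΛ : ℝ := max r 0 + ‖D.pt 0‖ + 1 with hrΛ
  have hΩ : D.carrier ⊆ closedBall (0 : ℂ) rΛ := hr.trans (closedBall_subset_closedBall (by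
    rw [hrΛ]; linarith [le_max_left r 0, norm_nonneg (D.pt 0)]))
  have hball : ball (D.pt 0) 1 ⊆ closedBall (0 : ℂ) rΛ := by
    intro z hz
    rw [mem_ball] at hz
    rw [mem_closedBall, dist_zero_right]
    have := norm_le_norm_add_norm_sub' z (D.pt 0)
    rw [← dist_eq_norm] at this
    rw [hrΛ]
    linarith [le_max_right r 0]
  -- the mesh threshold `δ₀ = δ₂ / 2 < δ₂`
  refine ⟨rΛ, δ₂ / 2, half_pos hδ₂', fun δ hδ γ ↦ ?_⟩
  have hδpos : 0 < δ := hδ.1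
  have hδδ₂ : δ < δ₂ := hδ.2.trans_lt (half_lt_self hδ₂')
  refine range_toCurve_domainSAW_subset γ fun p hp ↦ ?_
  rw [SimpleGraph.Walk.mem_support_iff] at hp
  rcases hp with rfl | hp
  · exact hball (hsub₂ ⟨hδpos, hδδ₂⟩)
  · exact hΩ (meshDomain_subset_meshVertices _ _
      (mem_meshDomain_of_mem_tail_support γ.walk p hp))

end Summit.CriticalPhenomena.SAWScalingLimit.Theorems

end
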